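import Summits.HubbardSuperconductivity.HubbardSuperconductivity.Theorems.JosephsonMirrorJmCuspShibaDictionary
import Summits.HubbardSuperconductivity.HubbardSuperconductivity.Theorems.BalabanIRBirEveryGroundStateStubLiebAnchor
import HarnessLib

/-!
# Route `JosephsonMirror` — crux `JmCusp` (stmt-HubbardSuperconductivity-2228):
# the Shiba dictionary is load-bearing — half-filled floors are simple in EVERY spin sector

Helper file (`--supports stmt-HubbardSuperconductivity-2228`), companion of
`JosephsonMirrorJmCuspShibaDictionary.lean` (clause (ii) of `JmCusp` at `(U, δ)` ⇔ eventual
simplicity of the half-filled ATTRACTIVE torus floor in the magnetised sector `S^z = N_L/2 - L²/2`).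

The dictionary `simpleFloor_hubbardTorus_iff_attractive` exchanges DOPING and MAGNETISATION:
`(N, S^z) = (2m, 0)` at coupling `U` ↔ `(L², m - L²/2)` at coupling `-U`.  Lieb's Theorem 1 (tree:
`finrank_szSector_groundEigenspace_eq_one`, spin-reflection positivity) makes the `(2m, 0)` floor of
the ATTRACTIVE torus simple for every `m ≤ L²`; transported, this is

* `simpleFloor_attractive_szZero` — Lieb's Theorem 1 in the line's `IsGroundStateInSector` format
  (`U < 0`, any even filling `2m ≤ 2L²`, any `L ≥ 1`);
* `simpleFloor_halfFilled_magnetised` — for every `U > 0`, every even `L ≥ 1` and EVERY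
  `m ≤ L²`, the floor of the half-filled REPULSIVE torus `hubbardTorus 2 L 1 U` in the spin sector
  `(L², S^z = m - L²/2)` is simple (Lieb 1989, proof of Theorem 2: uniqueness in each `S^z` sector
  at half filling; the tree's `LiebTwo` had the `S^z = 0` sector and the global `2S+1`-fold ground
  multiplet, not the magnetised sector floors);
* `jmCusp_halfFilled_everySpinSector_simple` — registered binder-free form.

Calibration map for clause (ii) (with p142929, p143372): simplicity of the `(N, S^z)` floor of the
repulsive torus is a THEOREM on the cross `{N = L²} × {all S^z}` (this file) and FALSE at `U = 0`
off closed shells; the bet's clause (ii) lives at `{N = N_L < L²} × {S^z = 0}`, whose Shiba dual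
`{N = L²} × {S^z = N_L/2 - L²/2 ≠ 0}` of the attractive model is exactly the arm not reached by
spin-reflection positivity (`N↑ ≠ N↓`).  No definition and no named fact is introduced.

References: E. H. Lieb, PRL 62 (1989) 1201, Theorem 1 and proof of Theorem 2.
-/

set_option linter.dupNamespace false

noncomputable section

namespace Summit.HubbardSuperconductivity.HubbardSuperconductivity.Theorems.JosephsonMirror

open Matrix Finset Literature.MathematicalPhysics.QuantumLattice Literature.Probability.LatticeModels

/-- **Lieb's Theorem 1 in sector format on the torus**: for `U < 0`, `L ≥ 1` and `m ≤ L²`, any two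
ground states of `hubbardTorus 2 L 1 U` in the sector `(2m, S^z = 0)` are proportional
(`finrank_szSector_groundEigenspace_eq_one` + `fermionTorusGraph_connected`).
[cite: Lieb1989, Theorem 1] -/
theorem simpleFloor_attractive_szZero {L : ℕ} [NeZero L] {U : ℝ} (hU : U < 0) {m : ℕ} (hm : m ≤ L ^ 2)
    (φ φ' : Fock (Orb (FermionTorus 2 L)))
    (hφ : IsGroundStateInSector (hubbardTorus 2 L 1 U) (2 * m) 0 φ)
    (hφ' : IsGroundStateInSector (hubbardTorus 2 L 1 U) (2 * m) 0 φ') : ∃ c : ℂ, φ' = c • φ := by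
  have hcard : Fintype.card (FermionTorus 2 L) = L ^ 2 := by simp [FermionTorus, Fintype.card_fin]
  have hmL : m ≤ Fintype.card (FermionTorus 2 L) := by rw [hcard]; exact hm
  have hfin := finrank_szSector_groundEigenspace_eq_one (fermionTorusGraph 2 L)
    (Summit.HubbardSuperconductivity.HubbardSuperconductivity.Theorems.fermionTorusGraph_connected 2 L)
    one_ne_zero hU hmL
  set H := hubbardTorus 2 L 1 U with hH
  set W : Submodule ℂ (Fock (Orb (FermionTorus 2 L))) := szSector (Λ := FermionTorus 2 L) (2 * m) 0 ⊓
      Module.End.eigenspace (Matrix.toLin' H) (((H.minEnergyOn (szSector (2 * m) 0) : ℝ) : ℂ)) with hW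
  have hmem : ∀ ψ : Fock (Orb (FermionTorus 2 L)), IsGroundStateInSector H (2 * m) 0 ψ → ψ ∈ W :=
    fun ψ hψ => Submodule.mem_inf.2
      ⟨hψ.1, Module.End.mem_eigenspace_iff.2 (by rw [Matrix.toLin'_apply]; exact hψ.2.2)⟩
  have hφ0 : (⟨φ, hmem φ hφ⟩ : W) ≠ 0 := fun h => hφ.2.1 (congrArg Subtype.val h)
  obtain ⟨c, hc⟩ := (finrank_eq_one_iff_of_nonzero' (⟨φ, hmem φ hφ⟩ : W) hφ0).1 hfin ⟨φ', hmem φ' hφ'⟩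
  exact ⟨c, (congrArg Subtype.val hc).symm⟩

/-- **Half-filled floors of the repulsive torus are simple in every spin sector.**  For `U > 0`,
`L ≥ 1` even and every `m ≤ L²`, any two ground states of `hubbardTorus 2 L 1 U` in the sector
`(N, S^z) = (L², m - L²/2)` are proportional: the Shiba dictionary
(`simpleFloor_hubbardTorus_iff_attractive` at coupling `-U`) turns the sector into the
`(2m, S^z = 0)` sector of the ATTRACTIVE torus at coupling `-U < 0`, where Lieb's Theorem 1 applies.
This is the uniqueness-in-each-`S^z`-sector step of Lieb's proof of Theorem 2.
[cite: Lieb1989, proof of Theorem 2] -/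
theorem simpleFloor_halfFilled_magnetised {L : ℕ} [NeZero L] (hL : Even L) {U : ℝ} (hU : 0 < U)
    {m : ℕ} (hm : m ≤ L ^ 2) (ψ ψ' : Fock (Orb (FermionTorus 2 L)))
    (hψ : IsGroundStateInSector (hubbardTorus 2 L 1 U) (L ^ 2) ((m : ℝ) - (L : ℝ) ^ 2 / 2) ψ)
    (hψ' : IsGroundStateInSector (hubbardTorus 2 L 1 U) (L ^ 2) ((m : ℝ) - (L : ℝ) ^ 2 / 2) ψ') :
    ∃ c : ℂ, ψ' = c • ψ := by
  have h := (simpleFloor_hubbardTorus_iff_attractive hL 1 (-U) hm).1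
    (fun φ φ' hφ hφ' => simpleFloor_attractive_szZero (neg_neg_of_pos hU) hm φ φ' hφ hφ')
  rw [neg_neg] at h
  exact h ψ ψ' hψ hψ'

/-- **Registered sub-goal form** (binder-free, fully qualified; the signature registered on
stmt-HubbardSuperconductivity-2228): for every `U > 0`, every even `L ≥ 1` and every `m ≤ L²` the
half-filled floor of the repulsive torus in the spin sector `S^z = m - L²/2` is simple.
[cite: Lieb1989, proof of Theorem 2] -/
theorem jmCusp_halfFilled_everySpinSector_simple : ∀ (U : ℝ), 0 < U → ∀ (L : ℕ) [NeZero L], Even L → ∀ (m : ℕ), m ≤ L ^ 2 → ∀ ψ ψ' : Literature.MathematicalPhysics.QuantumLattice.Fock (Literature.MathematicalPhysics.QuantumLattice.Orb (Literature.MathematicalPhysics.QuantumLattice.FermionTorus 2 L)), Literature.MathematicalPhysics.QuantumLattice.IsGroundStateInSector (Literature.MathematicalPhysics.QuantumLattice.hubbardTorus 2 L 1 U) (L ^ 2) ((m : ℝ) - (L : ℝ) ^ 2 / 2) ψ → Literature.MathematicalPhysics.QuantumLattice.IsGroundStateInSector (Literature.MathematicalPhysics.QuantumLattice.hubbardTorus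 2 L 1 U) (L ^ 2) ((m : ℝ) - (L : ℝ) ^ 2 / 2) ψ' → ∃ c : ℂ, ψ' = c • ψ :=
  fun _ hU _ _ hL _ hm ψ ψ' hψ hψ' => simpleFloor_halfFilled_magnetised hL hU hm ψ ψ' hψ hψ'

end Summit.HubbardSuperconductivity.HubbardSuperconductivity.Theorems.JosephsonMirror

end
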